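import Summits.QuantumFields.YangMills.Theses.SourcedPressureJensen
import Summits.QuantumFields.YangMills.Theorems.SourcedPressureJensenColdBoxSourcedPressureCgfTaylorBound
import Summits.QuantumFields.YangMills.Theorems.SourcedPressureJensenJensenFloorToolkit

/-!
# Birth skeleton (BC3) for the crux `ColdBoxSourcedPressure` (KS1′, stmt-QuantumFields-23996) of route `SourcedPressureJensen`

KS1′ (free-cell sourced Laplace, rev 7) ⇐ stub_firstOrder + stub_tiltedVariance, composed through the landed generic
cumulant bound `log ∫ e^{−hX} dν ≤ −h E_ν X + (h²/2)·sup_{0<u<h} Var[X; ν.tilted (−uX)]`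
(`Theorems/SourcedPressureJensenColdBoxSourcedPressureCgfTaylorBound.lean`, p589175):

* the FREE-CELL STATE inside the torus of side `L+1` is the tilt `ν = μ_T.tilted (β·S_out)` of the torus Wilson state by the
  Wilson cost of every plaquette NOT inside the cell `[0,ℓ]⁴` (so `E_T[F e^{βS_out}]/E_T[e^{βS_out}] = ∫ F dν`, proved here:
  `ratio_eq_integral_freeCellState`);
* `stub_firstOrder` (size L/XL — the free-cell Laplace step at FIRST order in the source, i.e. the summed two-plaquette
  covariance floor of the free cell with a centring window): `((ℓ+1)⁴)⁻¹ E_ν[X] ≥ σ C(n)² − C β^(−κ)` for the source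
  `X = Σ_{pairs inside} (βc_x − m)(βc_{x+ne₀} − m)`, `|m| ≤ W`, cells `ℓ+1 ∈ [β^θ, 4β^θ]`, `1 ≤ n ≤ 2β^A`, `0 < A < θ ≤ θ₁`;
* `stub_tiltedVariance` (size XL — the `h̃`-tilted susceptibility of the source in the free cell):
  `Var[X; ν.tilted (−uX)] ≤ M (ℓ+1)⁴` for `0 < u ≤ h₀(W)`, same ranges, `θ ≤ θ₂`;
* `ColdBoxSourcedPressure_of` — the composition, PROVED: `θ = min θ₁ θ₂`, `A = θ/2`, and for each `W`:
  `M_KS = M/2`, `C_KS = |C|`, `h₀,KS = min h₀ 1`, `β₀,KS = max (max β₁ β₂) 1`.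

Objects: `cellSource` (the source `X`), `outsideAction` (`S_out`), `freeCellState` (`ν`) — written with the literal
sub-expressions of the route decl so that the composition closes the crux BY NAME.
HONEST LABEL: skeleton of a crux of a RECORD-label rung line (target `WeakCouplingRates.XiPow`, an UPPER bound on the lattice gap);
the Yang–Mills mass gap is NOT proved by anything here.
-/

set_option autoImplicit false

noncomputable section

open MeasureTheory ProbabilityTheory Filter Topology
open Literature.MathematicalPhysics.QuantumFieldTheory Literature.MathematicalPhysics.QuantumLattice
open Summit.QuantumFields.YangMills.Theorems.WeakCouplingRates
open Summit.QuantumFields.YangMills.Theorems.SourcedPressureJensen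

namespace Summit.QuantumFields.YangMills.Cruxes.ColdBoxSourcedPressure.Birth

variable {G : Type} [Group G] [TopologicalSpace G] [IsTopologicalGroup G] [CompactSpace G]
  [MeasurableSpace G] [BorelSpace G]

/-! ### The objects of the free-cell statement -/

/-- The SOURCE of KS1′: `X(U) = Σ_x [pair (x, x+ne₀) inside the cell [0,ℓ]⁴] (βc_x(U) − m)(βc_{x+ne₀}(U) − m)` on the torus of
side `L+1` (the literal sub-expression of `ColdBoxSourcedPressure`). -/
def cellSource (r : LatticeRep G) (β m : ℝ) (ℓ n L : ℕ) (U : GaugeConfig 4 (L + 1) G) : ℝ :=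
  ∑ x : Fin 4 → Fin (L + 1), if ((∀ k : Fin 4, ((x k : ℕ)) ≤ ℓ) ∧ ((x 1 : ℕ)) + 1 ≤ ℓ ∧ ((x 2 : ℕ)) + 1 ≤ ℓ ∧
      ((x 0 : ℕ)) + n ≤ ℓ) then toTorusObservable (L + 1) (fun V => (β * plaqCost0 (d := 4) r.ρ 1 2
        (configShift (fun k => -((x k : ℕ) : ℤ)) V) - m) * (β * plaqCost0 (d := 4) r.ρ 1 2
          (timeShiftLG (G := G) n (configShift (fun k => -((x k : ℕ) : ℤ)) V)) - m)) U else 0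

/-- The OUTSIDE ACTION of KS1′: `S_out(U) = Σ` of the Wilson costs of all plaquettes of the torus of side `L+1` that are NOT inside
the cell `[0,ℓ]⁴` (the literal sub-expression of `ColdBoxSourcedPressure`). -/
def outsideAction (r : LatticeRep G) (ℓ L : ℕ) (U : GaugeConfig 4 (L + 1) G) : ℝ :=
  ∑ x : Fin 4 → Fin (L + 1), ∑ i : Fin 4, ∑ j : Fin 4, if i < j ∧ ¬ ((∀ k : Fin 4, ((x k : ℕ)) ≤ ℓ) ∧ ((x i : ℕ)) + 1 ≤ ℓ ∧
      ((x j : ℕ)) + 1 ≤ ℓ) then toTorusObservable (L + 1) (fun V => plaqCost0 (d := 4) r.ρ i j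
        (configShift (fun k => -((x k : ℕ) : ℤ)) V)) U else 0

/-- The FREE-CELL STATE inside the torus: the torus Wilson state of side `L+1` tilted by `+β·S_out` — the outside plaquette
weights are removed, so this is (Haar on the outside links) × (free-boundary Wilson measure of the cell `[0,ℓ]⁴`). -/
def freeCellState (r : LatticeRep G) (β : ℝ) (ℓ L : ℕ) : Measure (GaugeConfig 4 (L + 1) G) :=
  (wilsonMeasure (d := 4) (L := L + 1) r.ρ β).tilted (fun U => β * outsideAction r ℓ L U)

/-! ### Continuity, boundedness, integrability -/

omit [BorelSpace G] in
/-- The source is continuous. -/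
theorem continuous_cellSource (r : LatticeRep G) (β m : ℝ) (ℓ n L : ℕ) : Continuous (cellSource r β m ℓ n L) := by
  unfold cellSource
  refine continuous_finsetSum _ fun x _ => ?_
  split_ifs
  · exact continuous_toTorusObservable (continuous_sourceDensity r β m n _)
  · exact continuous_const

omit [BorelSpace G] in
/-- The outside action is continuous. -/
theorem continuous_outsideAction (r : LatticeRep G) (ℓ L : ℕ) : Continuous (outsideAction r ℓ L) := by
  unfold outsideAction
  refine continuous_finsetSum _ fun x _ => continuous_finsetSum _ fun i _ => continuous_finsetSum _ fun j _ => ?_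
  split_ifs
  · exact continuous_toTorusObservable
      (((continuous_bounded_plaqCost0 r.ρ r.continuous i j).1).comp
        (Summit.QuantumFields.YangMills.Theorems.SourcedPressureJensen.continuous_configShift _))
  · exact continuous_const

omit [Group G] [IsTopologicalGroup G] [MeasurableSpace G] [BorelSpace G] in
/-- A continuous real function on the (compact) torus configuration space is bounded. -/
theorem exists_abs_le_of_continuous {L : ℕ} {f : GaugeConfig 4 L G → ℝ} (hf : Continuous f) :
    ∃ K : ℝ, ∀ U, |f U| ≤ K := by
  have hc : IsCompact (Set.range f) := isCompact_range hf
  obtain ⟨K, hK⟩ := hc.isBounded.subset_closedBall 0 |>.imp fun K h => h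
  · exact ⟨K, fun U => by
      have := hK (Set.mem_range_self U)
      simpa [Metric.mem_closedBall, Real.dist_eq] using this⟩

/-- The free-cell state is a probability measure. -/
theorem isProbabilityMeasure_freeCellState (r : LatticeRep G) (β : ℝ) (ℓ L : ℕ) :
    IsProbabilityMeasure (freeCellState r β ℓ L) := by
  haveI := isProbabilityMeasure_wilsonMeasure (d := 4) (L := L + 1) (G := G) r.ρ r.continuous β
  exact isProbabilityMeasure_tilted
    (integrable_of_continuous r β (Real.continuous_exp.comp (continuous_const.mul (continuous_outsideAction r ℓ L))))

/-- The source has all exponential moments under the free-cell state (it is bounded). -/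
theorem integrable_exp_mul_cellSource (r : LatticeRep G) (β m : ℝ) (ℓ n L : ℕ) (t : ℝ) :
    Integrable (fun U => Real.exp (t * cellSource r β m ℓ n L U)) (freeCellState r β ℓ L) := by
  haveI := isProbabilityMeasure_freeCellState r β ℓ L
  haveI := r.secondCountableTopology
  obtain ⟨K, hK⟩ := exists_abs_le_of_continuous (continuous_cellSource r β m ℓ n L)
  exact integrable_exp_mul_of_abs_le (continuous_cellSource r β m ℓ n L).aestronglyMeasurable (ae_of_all _ hK) t

/-- **The ratio of torus expectations in `ColdBoxSourcedPressure` is the free-cell expectation**: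
`E_T[F · e^{βS_out}] / E_T[e^{βS_out}] = ∫ F dν`, `ν = freeCellState`. -/
theorem ratio_eq_integral_freeCellState (r : LatticeRep G) (β : ℝ) (ℓ L : ℕ) (F : GaugeConfig 4 (L + 1) G → ℝ) :
    wilsonExpectation (L := L + 1) r.ρ β (fun U => F U * Real.exp (β * outsideAction r ℓ L U)) /
        wilsonExpectation (L := L + 1) r.ρ β (fun U => Real.exp (β * outsideAction r ℓ L U)) =
      ∫ U, F U ∂(freeCellState r β ℓ L) := by
  unfold freeCellState wilsonExpectation
  rw [integral_tilted]
  simp only [smul_eq_mul]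
  rw [← integral_div]
  refine integral_congr_ae (ae_of_all _ fun U => ?_)
  simp only
  ring

/-! ### The two stubs -/

/-- stub 1 (FIRST ORDER IN THE SOURCE — the free-cell two-plaquette covariance floor, summed over the interior pairs, with a centring
window; size L/XL): there are `θ₁ > 0` and a Gaussian constant `σ > 0` such that for all `0 < A < θ ≤ θ₁` some rate `κ > 0` works:
for every window `W` (constants `C, β₀` depending on `W`), `β ≥ β₀`, `|m| ≤ W`, cells `ℓ+1 ∈ [β^θ, 4β^θ]`, `1 ≤ n ≤ 2β^A` and ambient
tori `L+1 ≥ ℓ+2`: `σ·C(n)² − C·β^(−κ) ≤ ((ℓ+1)⁴)⁻¹ · E_{free cell}[X]`.  (Mechanism: Chatterjee's free cube in axial gauge + the tree's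
`ExpChartPackage2` at first order in the source: `E[(βc_x − m)(βc_{x+n} − m)] = β²Cov(c_x, c_{x+n}) + (βE c_x − m)(βE c_{x+n} − m)`,
the product term is `≥ −O(boundary layer)`, the covariance is `σ·C_cell(x,x+n)²·(1 + O(β^{cθ−1/2}))` with `C_cell → C(n)` off an
`O(1/ℓ)` boundary layer; missing pairs near the far faces cost `≤ 3β^{A−θ}·σC(0)²`.) -/
theorem stub_firstOrder :
    ∀ (G : Type) [Group G] [TopologicalSpace G] [IsTopologicalGroup G] [CompactSpace G] [MeasurableSpace G]
      [BorelSpace G], IsCompactSimpleLieGroup G → ∀ r : LatticeRep G, ∃ θ₁ : ℝ, 0 < θ₁ ∧ ∃ σ : ℝ, 0 < σ ∧ ∀ θ A : ℝ, 0 < A → A < θ → θ ≤ θ₁ → ∃ κ : ℝ, 0 < κ ∧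
        ∀ W : ℝ, ∃ C β₀ : ℝ, ∀ β : ℝ, β₀ ≤ β → ∀ m : ℝ, |m| ≤ W → ∀ ℓ : ℕ, β ^ θ ≤ (ℓ + 1 : ℝ) → (ℓ + 1 : ℝ) ≤ 4 * β ^ θ →
          ∀ n : ℕ, 1 ≤ n → (n : ℝ) ≤ 2 * β ^ A → ∀ L : ℕ, ℓ + 1 ≤ L →
            σ * (curvaturePlaquetteCorr (d := 4) (by norm_num) (n : ℤ)) ^ 2 - C * β ^ (-κ) ≤
              ((ℓ + 1 : ℝ) ^ 4)⁻¹ * ∫ U, cellSource r β m ℓ n L U ∂(freeCellState r β ℓ L) := by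
  sorry

/-- stub 2 (TILTED SUSCEPTIBILITY — second order in the source; size XL): there is `θ₂ > 0` such that for all `0 < A < θ ≤ θ₂` and every
window `W` (constants `M, h₀ > 0, β₀` depending on `W`): for `β ≥ β₀`, `|m| ≤ W`, cells `ℓ+1 ∈ [β^θ, 4β^θ]`, `1 ≤ n ≤ 2β^A`, ambient tori
`L+1 ≥ ℓ+2` and every source strength `0 < u ≤ h₀`, the variance of the source under the SOURCED free-cell state
`ν.tilted (−u·X)` is at most `M·(ℓ+1)⁴` (volume-normalised susceptibility of `X` uniformly in the tilt: summable decay of the truncated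
pair–pair correlations `Cov_u(H_x, H_y)` in a cold free cell, large fields priced uniformly in `u`). -/
theorem stub_tiltedVariance :
    ∀ (G : Type) [Group G] [TopologicalSpace G] [IsTopologicalGroup G] [CompactSpace G] [MeasurableSpace G]
      [BorelSpace G], IsCompactSimpleLieGroup G → ∀ r : LatticeRep G, ∃ θ₂ : ℝ, 0 < θ₂ ∧ ∀ θ A : ℝ, 0 < A → A < θ → θ ≤ θ₂ →
        ∀ W : ℝ, ∃ M h₀ β₀ : ℝ, 0 < h₀ ∧ ∀ β : ℝ, β₀ ≤ β → ∀ m : ℝ, |m| ≤ W → ∀ ℓ : ℕ, β ^ θ ≤ (ℓ + 1 : ℝ) →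
          (ℓ + 1 : ℝ) ≤ 4 * β ^ θ → ∀ n : ℕ, 1 ≤ n → (n : ℝ) ≤ 2 * β ^ A → ∀ L : ℕ, ℓ + 1 ≤ L → ∀ u : ℝ, 0 < u → u ≤ h₀ →
            Var[cellSource r β m ℓ n L; (freeCellState r β ℓ L).tilted (fun U => -u * cellSource r β m ℓ n L U)] ≤
              M * (ℓ + 1 : ℝ) ^ 4 := by
  sorry

/-! ### The composition -/

/-- The composition (uses the two sorried stubs BY NAME; sorry-free itself): `θ = min θ₁ θ₂`, `A = θ/2`; per window
`M/2, |C|, min h₀ 1, max (max β₁ β₂) 1`. -/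
theorem ColdBoxSourcedPressure_of :
    Summit.QuantumFields.YangMills.Theses.SourcedPressureJensen.ColdBoxSourcedPressure := by
  intro G _ _ _ _ hG
  letI : MeasurableSpace G := borel G
  haveI : BorelSpace G := ⟨rfl⟩
  intro r
  obtain ⟨θ₁, hθ₁, σ, hσ, H1⟩ := stub_firstOrder G hG r
  obtain ⟨θ₂, hθ₂, H2⟩ := stub_tiltedVariance G hG r
  have hθ : 0 < min θ₁ θ₂ := lt_min hθ₁ hθ₂
  obtain ⟨κ, hκ, H1W⟩ := H1 (min θ₁ θ₂) (min θ₁ θ₂ / 2) (by linarith) (by linarith) (min_le_left _ _)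
  have H2W := H2 (min θ₁ θ₂) (min θ₁ θ₂ / 2) (by linarith) (by linarith) (min_le_right _ _)
  refine ⟨min θ₁ θ₂, κ, min θ₁ θ₂ / 2, σ, by linarith, by linarith, hκ, hσ, fun W => ?_⟩
  obtain ⟨C, β₁, HC⟩ := H1W W
  obtain ⟨M, h₀, β₂, hh₀, HM⟩ := H2W W
  refine ⟨M / 2, |C|, min h₀ 1, max (max β₁ β₂) 1, lt_min hh₀ one_pos, ?_⟩
  intro β hβ m hm ℓ hℓ1 hℓ2 n hn hnA h hh hhle L hL
  have hβ₁ : β₁ ≤ β := le_trans (le_trans (le_max_left _ _) (le_max_left _ _)) hβ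
  have hβ₂ : β₂ ≤ β := le_trans (le_trans (le_max_right _ _) (le_max_left _ _)) hβ
  have hβ1 : 1 ≤ β := le_trans (le_max_right _ _) hβ
  have hh0 : h ≤ h₀ := hhle.trans (min_le_left _ _)
  have hh1 : h ≤ 1 := hhle.trans (min_le_right _ _)
  -- the free-cell state and the source
  haveI : IsProbabilityMeasure (freeCellState r β ℓ L) := isProbabilityMeasure_freeCellState r β ℓ L
  have hXexp := integrable_exp_mul_cellSource r β m ℓ n L
  -- second order: the generic cumulant bound with the tilted susceptibility of stub 2
  have hV : ∀ u ∈ Set.Ioo 0 h, Var[cellSource r β m ℓ n L;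
      (freeCellState r β ℓ L).tilted (fun U => -u * cellSource r β m ℓ n L U)] ≤ M * (ℓ + 1 : ℝ) ^ 4 :=
    fun u hu => HM β hβ₂ m hm ℓ hℓ1 hℓ2 n hn hnA L hL u hu.1 (hu.2.le.trans hh0)
  have hmain := log_integral_exp_neg_mul_le_of_variance_tilted_le hXexp hh hV
  -- first order: stub 1
  have hfloor := HC β hβ₁ m hm ℓ hℓ1 hℓ2 n hn hnA L hL
  -- rewrite the goal through the free-cell state
  have hratio := ratio_eq_integral_freeCellState r β ℓ L (fun U => Real.exp (-h * cellSource r β m ℓ n L U))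
  change ((ℓ + 1 : ℝ) ^ 4)⁻¹ * Real.log (wilsonExpectation (L := L + 1) r.ρ β (fun U =>
      Real.exp (-h * cellSource r β m ℓ n L U) * Real.exp (β * outsideAction r ℓ L U)) /
      wilsonExpectation (L := L + 1) r.ρ β (fun U => Real.exp (β * outsideAction r ℓ L U))) ≤
    -h * (σ * (curvaturePlaquetteCorr (d := 4) (by norm_num) (n : ℤ)) ^ 2) + |C| * β ^ (-κ) + M / 2 * h ^ 2
  rw [hratio]
  -- arithmetic
  have hvol : (0 : ℝ) < ((ℓ + 1 : ℝ) ^ 4)⁻¹ := by positivity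
  have hvol' : (0 : ℝ) < (ℓ + 1 : ℝ) ^ 4 := by positivity
  have hβ0 : 0 ≤ β ^ (-κ) := Real.rpow_nonneg (by linarith) _
  have step1 : ((ℓ + 1 : ℝ) ^ 4)⁻¹ * Real.log (∫ U, Real.exp (-h * cellSource r β m ℓ n L U) ∂freeCellState r β ℓ L) ≤
      ((ℓ + 1 : ℝ) ^ 4)⁻¹ * (-h * ∫ U, cellSource r β m ℓ n L U ∂freeCellState r β ℓ L + M * (ℓ + 1 : ℝ) ^ 4 * h ^ 2 / 2) :=
    mul_le_mul_of_nonneg_left hmain hvol.le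
  have step2 : ((ℓ + 1 : ℝ) ^ 4)⁻¹ * (-h * ∫ U, cellSource r β m ℓ n L U ∂freeCellState r β ℓ L + M * (ℓ + 1 : ℝ) ^ 4 * h ^ 2 / 2) =
      -h * (((ℓ + 1 : ℝ) ^ 4)⁻¹ * ∫ U, cellSource r β m ℓ n L U ∂freeCellState r β ℓ L) + M / 2 * h ^ 2 := by
    field_simp
  have step3 : -h * (((ℓ + 1 : ℝ) ^ 4)⁻¹ * ∫ U, cellSource r β m ℓ n L U ∂freeCellState r β ℓ L) ≤
      -h * (σ * (curvaturePlaquetteCorr (d := 4) (by norm_num) (n : ℤ)) ^ 2 - C * β ^ (-κ)) := by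
    nlinarith [hfloor, hh]
  have step4 : h * (C * β ^ (-κ)) ≤ |C| * β ^ (-κ) := by
    have : C * β ^ (-κ) ≤ |C| * β ^ (-κ) := mul_le_mul_of_nonneg_right (le_abs_self C) hβ0
    have : h * (|C| * β ^ (-κ)) ≤ 1 * (|C| * β ^ (-κ)) :=
      mul_le_mul_of_nonneg_right hh1 (mul_nonneg (abs_nonneg C) hβ0)
    nlinarith [hh, hβ0, abs_nonneg C]
  linarith [step1, step2, step3, step4]

end Summit.QuantumFields.YangMills.Cruxes.ColdBoxSourcedPressure.Birth

end
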